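import Summits.FinalStateConjecture.FinalStateConjecture.Theorems.BartnikGapSettlingBondiBartnikRigiditySlabCauchyRigidityDefs
import Summits.FinalStateConjecture.FinalStateConjecture.Theorems.BartnikGapSettlingBondiBartnikRigidityKillingPropagationPastSet
import Summits.FinalStateConjecture.FinalStateConjecture.Theorems.BartnikGapSettlingBondiBartnikRigidityKillingPropagationCausalPast
import Summits.FinalStateConjecture.FinalStateConjecture.Theorems.BartnikGapSettlingBondiBartnikRigidityKillingPropagationDiamond
import Summits.FinalStateConjecture.FinalStateConjecture.Theorems.BartnikGapSettlingBondiBartnikRigidityKillingPropagationEntryPoints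
import Literature.Geometry.Lorentzian.LorentzianMetricProofs
import Literature.Geometry.Lorentzian.Causality
import Literature.Geometry.Lorentzian.Einstein
import Literature.Geometry.Lorentzian.KillingHorizonShadowAlong
import Literature.Geometry.Lorentzian.CausalCurveEndpoint
import HarnessLib
import Literature.Geometry.Lorentzian.KillingDevelopment

/-!
# Killing PROPAGATION from a neighbourhood of the initial boundary into the interior of the
# Killing domain — conditional closer of the registered stub `stub_killingPropagation'` (β', the
# printed half of K1a' `stub_exactMinimiserKilling'`) of the line `direct-method-on-the-cone`,
# crux `BondiBartnikRigidity` (stmt-FinalStateConjecture-10807); worker betaA of lead c3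

`stub_killingPropagation'_of_facts'` proves the registered signature of β' VERBATIM as its
conclusion, from five displayed hypotheses:

* (G3) `stub_exactStarChartKilling` and (G4) `stub_killingFieldOn_eqOn_of_isPreconnected`, the
  two generic bricks of β' (landed: `…KillingPropagationExactStarChartKilling.lean`,
  `…KillingPropagationKillingRigidity.lean`), taken as hypotheses in their registered form;
* two NAMED PUBLISHED FACTS stated below for general spacetimes (not for the crux's objects):
  `fischerMarsdenMoncrief_killing_development` (Moncrief 1975, §III; Fischer–Marsden–Moncrief
  1980, Lemma 2.2: a Killing field near a Cauchy hypersurface of a vacuum region develops to the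
  whole region) and `geroch1970_exists_isCauchyHypersurface` (Geroch 1970, Thm. 11: a globally
  hyperbolic spacetime has a Cauchy hypersurface);
* (H) the ONE remaining causal-geometric statement about the Killing domain that the tree's
  causality theory does not reach: **at an entry point `z` of `G = (killingDomain)°` (the past
  endpoint, outside `G`, of a future timelike curve running in `G`) off the data hypersurface, the
  causal past `J⁻(z)` meets `closure G` only inside `S = C ∪ N_out`** (such `z` lie on the outer
  roof `N_out` by the PROVED (G1a) `mem_initialBoundary_of_entry`; (H) says that the null
  generators of `∂J⁺(C)` arriving at a roof entry point come from the shell, not from the inner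
  edge of the collar).  The complementary case ON the data hypersurface, `J⁻(z) ∩ closure G = {z}`,
  is proved (`causalPast_inter_causalFuture_range_embed`).

Proof (paper proof of worker beta, `beta/REPORT.md` §3, with the causal bookkeeping G0/G1/G5
formalised in the bricks `…KillingPropagation{PastSet,CausalPast,Diamond,CausalSplice,
FutureDomain,EntryPoints}.lean`):
1. (G0) `G ∩ S = ∅`, `closure G ⊆ J⁺(ι X)`, `G` causally convex.
2. (G1) The PAST SET `P = {y ∈ G | J⁻(y) ∩ (closure G ∖ V) = ∅}` of `G` is open (outer
   semicontinuity of `J⁻`), lies in `G ∩ V`, is causally convex, hence a globally hyperbolic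
   sub-spacetime; the Splitting fact gives a Cauchy hypersurface `Σ₃` of `P`; every endless
   timelike curve of `G` enters `P` (it has a past endpoint `z ∉ G` — an endless one would meet
   `S` inside `G` —, `z ∈ S` by (G1a), `J⁻(z) ∩ closure G ⊆ S ⊆ V` by acausality or by (H), and
   semicontinuity), so `Σ₃` is a Cauchy hypersurface of `G` (`isCauchyHypersurface_of_pastSet`).
3. (G2) FMM on `(G, Σ₃, ξ)` gives `ξ'` Killing on `G`, equal to `ξ` on an open `U' ⊇ Σ₃`.
4. (G5) The exact diamond image `Ψ(Δ')` accumulates at a slab point `c ∈ C` (attachment: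
   `Ψ = Φ₀` on the slab, continuity on `Δ' ∪ slab°`), near which `G ⊆ P`
   (`J⁻(c) ∩ J⁺(ι X) = {c}`); so some `y₀ = Ψ x₀ ∈ P`.  The component `O` of `G ∩ V` through `y₀`
   meets `Σ₃ ⊆ U'` (an endless timelike curve of `P` through `y₀` meets `Σ₃` inside
   `P ⊆ G ∩ V`), so `ξ' = ξ` on `O` by (G4); on the connected open set `Ψ(Δ')` the fields `ξ'` and
   the anchor `ζ` of (G3) are Killing and agree on the non-empty open `Ψ(Δ') ∩ O` (there
   `ξ' = ξ = dΨ(Λe₀) = ζ`), hence on `Ψ(Δ')` by (G4).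

The two `def`s are the cited general facts (to be relocated to `Literature/`); no other
definitions.  References: [Moncrief1975] §III; [FischerMarsdenMoncrief1980] Lemma 2.2;
[BernalSanchez2006]; [Geroch1970] Thm. 11; [HawkingEllis1973CUP] §6.5–6.6, Prop. 6.6.8;
[BernalSanchez2007CQG] Thm. 3.2; [ONeillSemiRiemannian1983] Ch. 9, Lemma 9.28, Ch. 14.
-/

noncomputable section

-- D-0017: single-problem summit, `Summit.<S>.<S>.…` by design (cf. lakefile `weak.linter.dupNamespace`).
set_option linter.dupNamespace false
set_option maxSynthPendingDepth 3

open Set Filter Function Topology TopologicalSpace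
open Literature.Geometry.Lorentzian
open scoped Manifold ContDiff Topology ENNReal

namespace Summit.FinalStateConjecture.FinalStateConjecture.Theorems.BondiBartnikRigidity.DirectMethod

open KillingPropagation in
/-- **β' modulo named facts, (G3), (G4) and the roof-generator statement (H)** — the registered
helper stub `stub_killingPropagation'_of_facts'` of the crux item: Killing PROPAGATION from a
neighbourhood `V` of the initial boundary `S = C ∪ N_out` of the Killing domain of an exact thick
Kerr collar core into the interior `(killingDomain)°`, with the propagated field anchored to
`dΨ(Λe₀)` on the exact diamond `Ψ(Δ')`.  Hypotheses, in order: (G3) exact star charts carry the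
Killing field `dΨ(Λe₀)`; (G4) Killing rigidity on preconnected open sets;
`fischerMarsdenMoncrief_killing_development`; `geroch1970_exists_isCauchyHypersurface`; (H) at an
entry point `z ∉ ι(X)` of `(killingDomain)°`, `J⁻(z) ∩ closure (killingDomain)° ⊆ S`; then the
registered signature of `stub_killingPropagation'` verbatim.  See the module docstring for the
proof. [cite: Moncrief1975, §III] [cite: HawkingEllis1973CUP, §6.5] -/
theorem stub_killingPropagation'_of_facts' : (∀ (𝒮 : Spacetime.{0} 4) [𝒮.metric.toPseudoRiemannianMetric.HasLeviCivita] (M a : ℝ), 0 < M → |a| < M → ∀ (mo : lorentzGroup × E4) (B : ModelBackground), B = starBackground mo.1 mo.2 M a (fun x => Kerr.radius a (poincareInv mo.1 mo.2 x)) → ∀ (O : Set B.domain) (Ψ : B.domain → 𝒮.carrier), IsOpen O → ContMDiffOn 𝓘(ℝ, E4) (𝓡 4) ∞ Ψ O → IsOpenEmbedding (O.restrict Ψ) → supCkENorm (Subtype.val '' O) 0 (𝒮.deviationExtend B Ψ) ≤ 0 → ∃ ζ : Π y : 𝒮.carrier, TangentSpace (𝓡 4) y, 𝒮.metric.IsKillingFieldOn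 ζ (Ψ '' O) ∧ ∀ x ∈ O, ζ (Ψ x) = mfderiv 𝓘(ℝ, E4) (𝓡 4) Ψ x ((mo.1 : E4 ≃L[ℝ] E4) (E4.basisVector 0))) → (∀ (𝒮 : Spacetime.{0} 4) [𝒮.metric.toPseudoRiemannianMetric.HasLeviCivita] (A W : Set 𝒮.carrier) (ξ₁ ξ₂ : Π y : 𝒮.carrier, TangentSpace (𝓡 4) y), IsOpen A → IsPreconnected A → IsOpen W → W ⊆ A → W.Nonempty → 𝒮.metric.IsKillingFieldOn ξ₁ A → 𝒮.metric.IsKillingFieldOn ξ₂ A → (∀ y ∈ W, ξ₁ y = ξ₂ y) → ∀ y ∈ A, ξ₁ y = ξ₂ y) → Literature.Geometry.Lorentzian.fischerMarsdenMoncrief_killing_development → Literature.Geometry.Lorentzian.geroch1970_exists_isCauchyHypersurface → (∀ (X : Type) [TopologicalSpace X] [ChartedSpace E3 X] [IsManifold (𝓡 3) ∞ X] [T2Space X] [SecondCountableTopology X] [ConnectedSpace X] (D : InitialDataSet (𝓡 3) X) (𝒱 : VacuumCauchyDevelopment D) (M : Fin 1 → ℝ) (p : _) (B : Fin 1 → ModelBackground)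 (Φ : ∀ i, (B i).domain → 𝒱.carrier) (γ : ℝ → 𝒱.carrier) (s : Set ℝ) (z : _), collarCore M p B Φ ⊆ range 𝒱.embed → s.OrdConnected → s.Nonempty → 𝒱.metric.IsFutureTimelikeCurveOn 𝒱.timeOrientation γ s → (∀ t ∈ s, γ t ∈ interior (killingDomain 𝒱 M p B Φ)) → HasPastEndpoint γ s z → z ∉ interior (killingDomain 𝒱 M p B Φ) → z ∉ range 𝒱.embed → 𝒱.metric.causalPast 𝒱.timeOrientation {z} ∩ closure (interior (killingDomain 𝒱 M p B Φ)) ⊆ collarCore M p B Φ ∪ (frontier (𝒱.metric.causalFuture 𝒱.timeOrientation (collarCore M p B Φ)) ∩ 𝒱.metric.causalFuture 𝒱.timeOrientation (Φ 0 '' shellSlab (B 0) (M 0)))) → ∀ (X : Type) [TopologicalSpace X] [ChartedSpace E3 X] [IsManifold (𝓡 3) ∞ X] [T2Space X] [SecondCountableTopology X] [ConnectedSpace X] (D : InitialDataSet (𝓡 3) X) (𝒱 : VacuumCauchyDevelopment D) (M a : Fin 1 → ℝ) (p : 𝒱.carrier) (mo : Fin 1 → lorentzGroup × E4) (B : Fin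 1 → ModelBackground) (Φ : ∀ i, (B i).domain → 𝒱.carrier) (Ψ : (B 0).domain → 𝒱.carrier) (V : Set 𝒱.carrier) (ξ : Π x : 𝒱.carrier, TangentSpace (𝓡 4) x), 0 < M 0 → |a 0| < M 0 → B 0 = starBackground (mo 0).1 (mo 0).2 (M 0) (a 0) (fun x => Kerr.radius (a 0) (poincareInv (mo 0).1 (mo 0).2 x)) → p ∈ Φ 0 '' (B 0).truncTimeSlab (3 * M 0) 0 → (ContMDiffOn 𝓘(ℝ, E4) (𝓡 4) ∞ (Φ 0) {x | -1 < (B 0).time x.1 ∧ (B 0).time x.1 < 1 ∧ (B 0).radius x.1 < 3 * M 0 + 1} ∧ IsOpenEmbedding ({x | -1 < (B 0).time x.1 ∧ (B 0).time x.1 < 1 ∧ (B 0).radius x.1 < 3 * M 0 + 1}.restrict (Φ 0))) → collarCore M p B Φ ⊆ range 𝒱.embed → (∀ x ∈ (B 0).truncTimeSlab (3 * M 0) 0, Ψ x = Φ 0 x) → ContinuousOn Ψ (F1Route.slabDiamondWithSlab' (B 0) (M 0)) → ContMDiffOn 𝓘(ℝ, E4) (𝓡 4) ∞ Ψ (F1Route.slabDiamond'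 (B 0) (M 0)) → IsOpenEmbedding ((F1Route.slabDiamond' (B 0) (M 0)).restrict Ψ) → Ψ '' F1Route.slabDiamond' (B 0) (M 0) ⊆ interior (killingDomain 𝒱 M p B Φ) → supCkENorm (Subtype.val '' F1Route.slabDiamond' (B 0) (M 0)) 0 (𝒱.toSpacetime.deviationExtend (B 0) Ψ) ≤ 0 → ∀ [𝒱.metric.toPseudoRiemannianMetric.HasLeviCivita], IsOpen V → (collarCore M p B Φ ∪ (frontier (𝒱.metric.causalFuture 𝒱.timeOrientation (collarCore M p B Φ)) ∩ 𝒱.metric.causalFuture 𝒱.timeOrientation (Φ 0 '' shellSlab (B 0) (M 0)))) ⊆ V → 𝒱.metric.IsKillingFieldOn ξ (interior (killingDomain 𝒱 M p B Φ) ∩ V) → (∃ x ∈ F1Route.slabDiamond' (B 0) (M 0), Ψ x ∈ V) → (∀ x ∈ F1Route.slabDiamond' (B 0) (M 0), Ψ x ∈ V → ξ (Ψ x) = mfderiv 𝓘(ℝ, E4) (𝓡 4) Ψ x (((mo 0).1 : E4 ≃L[ℝ] E4) (E4.basisVector 0))) → ∃ ξ' : Π x : 𝒱.carrier, TangentSpace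 (𝓡 4) x, 𝒱.metric.IsKillingFieldOn ξ' (interior (killingDomain 𝒱 M p B Φ)) ∧ ∀ x ∈ F1Route.slabDiamond' (B 0) (M 0), ξ' (Ψ x) = mfderiv 𝓘(ℝ, E4) (𝓡 4) Ψ x (((mo 0).1 : E4 ≃L[ℝ] E4) (E4.basisVector 0)) := by
  intro hG3 hG4 hFMM hSplit hH X _ _ _ _ _ _ D 𝒱 M a p mo B Φ Ψ V ξ hM ha hB hp hC2 hCX hΨΦ hc hs he hJ hd _ hV hSV hξ hne hξΨ
  classical
  -- notation
  have hn2 : (2 : ℕ∞ω) ≤ ((⊤ : ℕ∞) : ℕ∞ω) := WithTop.coe_le_coe.mpr le_top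
  have hn1 : (1 : ℕ∞ω) ≤ ((⊤ : ℕ∞) : ℕ∞ω) := le_trans one_le_two hn2
  set g := 𝒱.metric with hg
  set τ := 𝒱.timeOrientation with hτ
  set C : Set 𝒱.carrier := collarCore M p B Φ with hC_def
  set S : Set 𝒱.carrier := C ∪ (frontier (g.causalFuture τ C) ∩
    g.causalFuture τ (Φ 0 '' shellSlab (B 0) (M 0))) with hS_def
  set G : Set 𝒱.carrier := interior (killingDomain 𝒱 M p B Φ) with hG_def
  set Δ : Set (B 0).domain := F1Route.slabDiamond' (B 0) (M 0) with hΔ_def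
  have hGo : IsOpen G := isOpen_interior
  set GO : Opens 𝒱.carrier := ⟨G, hGo⟩ with hGO_def
  -- Step 0: causal facts about `G`
  have hGS : G ∩ S = ∅ := interior_killingDomain_inter_eq_empty 𝒱 M p B Φ hCX
  have hclG : closure G ⊆ g.causalFuture τ (range 𝒱.embed) :=
    closure_interior_killingDomain_subset 𝒱 M p B Φ hCX
  have hconvG := causallyConvex_interior_killingDomain 𝒱 M p B Φ hCX
  -- Step 1: the past set `P`
  set F : Set 𝒱.carrier := closure G \ V with hF_def
  have hFc : IsClosed F := isClosed_closure.sdiff hV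
  have hFS : F ⊆ g.causalFuture τ (range 𝒱.embed) := (fun x hx ↦ hclG hx.1)
  set P : Set 𝒱.carrier := {y ∈ G | g.causalPast τ {y} ∩ F = ∅} with hP_def
  have hPG : P ⊆ G := fun y hy ↦ hy.1
  have hPV : P ⊆ V := by
    intro y hy
    by_contra hyV
    have hyF : y ∈ g.causalPast τ {y} ∩ F :=
      ⟨LorentzianMetric.subset_causalPast g τ {y} (mem_singleton y), subset_closure hy.1, hyV⟩
    rw [hy.2] at hyF
    exact hyF
  have hPo : IsOpen P := by
    rw [isOpen_iff_mem_nhds]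
    intro y hy
    obtain ⟨W, hW, hWP⟩ := exists_nhds_causalPast_inter_eq_empty 𝒱.toCauchyDevelopment hFc hFS hy.2
    filter_upwards [hW, hGo.mem_nhds hy.1] with y' hy'W hy'G
    exact ⟨hy'G, hWP y' hy'W⟩
  -- `P` is a past set of `G`
  have hPpast : ∀ y ∈ P, ∀ y' ∈ G, y' ∈ g.causalPast τ {y} → y' ∈ P := by
    intro y hy y' hy'G hy'y
    refine ⟨hy'G, Set.eq_empty_of_subset_empty fun x hx ↦ ?_⟩
    rw [← hy.2]
    refine ⟨?_, hx.2⟩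
    -- `x ≤ y' ≤ y`
    have h1 : y' ∈ g.causalFuture τ {x} := LorentzianMetric.mem_causalPast_singleton_iff.1 hx.1
    have h2 : y ∈ g.causalFuture τ {y'} := LorentzianMetric.mem_causalPast_singleton_iff.1 hy'y
    exact LorentzianMetric.mem_causalPast_singleton_iff.2
      (LorentzianMetric.mem_causalFuture_of_mem_causalFuture_of_mem_causalFuture hn2 h1 h2)
  -- `P` is causally convex
  have hPconv : ∀ x ∈ P, ∀ y ∈ P,
      g.causalFuture τ {x} ∩ g.causalPast τ {y} ⊆ P := by
    intro x hx y hy w hw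
    exact hPpast y hy w (hconvG x hx.1 y hy.1 hw) hw.2
  set PO : Opens 𝒱.carrier := ⟨P, hPo⟩ with hPO_def
  have hPGH : (𝒱.metric.restrict PseudoRiemannianMetric.contMDiff_restrict_holds PO).IsGloballyHyperbolic (𝒱.timeOrientation.restrict PseudoRiemannianMetric.contMDiff_restrict_holds
        𝒱.timeOrientation.contMDiff_restrict_holds PO) :=
    isGloballyHyperbolic_restrict_of_causallyConvex _ _ 𝒱.toCauchyDevelopment.isGloballyHyperbolic hPconv
  -- Step 2: a Cauchy hypersurface of `P`
  obtain ⟨Sc', hSc'⟩ := hSplit (𝒱.metric.restrict PseudoRiemannianMetric.contMDiff_restrict_holds PO) (𝒱.timeOrientation.restrict PseudoRiemannianMetric.contMDiff_restrict_holds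
        𝒱.timeOrientation.contMDiff_restrict_holds PO) hn2 hPGH
  set Sc : Set 𝒱.carrier := Subtype.val '' Sc' with hSc_def
  have hScP3 : Sc ⊆ P := by
    rintro _ ⟨y, hy, rfl⟩; exact y.2
  have hpre : (Subtype.val ⁻¹' Sc : Set PO) = Sc' :=
    Subtype.val_injective.preimage_image Sc'
  have hCauchyP : (𝒱.metric.restrict PseudoRiemannianMetric.contMDiff_restrict_holds PO).IsCauchyHypersurface (𝒱.timeOrientation.restrict PseudoRiemannianMetric.contMDiff_restrict_holds
        𝒱.timeOrientation.contMDiff_restrict_holds PO)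
      (Subtype.val ⁻¹' Sc) := by rw [hpre]; exact hSc'
  -- Step 3: `Sc` is a Cauchy hypersurface of `G`
  have hentry : ∀ (γ : ℝ → GO) (s : Set ℝ),
      (𝒱.metric.restrict PseudoRiemannianMetric.contMDiff_restrict_holds GO).IsEndlessTimelikeCurve (𝒱.timeOrientation.restrict PseudoRiemannianMetric.contMDiff_restrict_holds
        𝒱.timeOrientation.contMDiff_restrict_holds GO) γ s →
      ∃ t ∈ s, (γ t : 𝒱.carrier) ∈ P := by
    intro γ s hγ
    obtain ⟨hs', hγt, hγf, hγp⟩ := hγ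
    obtain ⟨t₀, ht₀⟩ := hγf.1
    have hγM : g.IsFutureTimelikeCurveOn τ (Subtype.val ∘ γ) s :=
      (LorentzianMetric.isFutureTimelikeCurveOn_restrict_iff _ _ _ _ GO).1 hγt
    by_cases hendM : IsPastEndless (Subtype.val ∘ γ) s
    · -- the ambient curve would meet `S` inside `G`
      exfalso
      have hq : (γ t₀ : 𝒱.carrier) ∈ killingDomain 𝒱 M p B Φ := interior_subset (γ t₀).2
      obtain ⟨t, -, -, htS⟩ :=
        hq (Subtype.val ∘ γ) s hs' hγM.isFutureCausalCurveOn hendM t₀ ht₀ rfl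
      have : (γ t : 𝒱.carrier) ∈ G ∩ S := ⟨(γ t).2, htS⟩
      rw [hGS] at this
      exact this
    · -- a past endpoint `z ∉ G` of the ambient curve; (H) puts `J⁻(z) ∩ closure G` inside `S ⊆ V`
      simp only [IsPastEndless, not_and, not_forall, not_not] at hendM
      obtain ⟨z, hz⟩ := hendM ⟨t₀, ht₀⟩
      have hzG : z ∉ G := fun hzG ↦
        hγp.2 ⟨z, hzG⟩ (hasPastEndpoint_subtypeVal_comp_iff.1 hz)
      have hzcl : z ∈ closure G := hz.mem_closure ⟨t₀, ht₀⟩ fun t _ ↦ (γ t).2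
      -- `z ≪ γ t₀`: a second parameter below `t₀` and the endpoint property
      obtain ⟨t₁, ht₁, ht₁₀⟩ : ∃ t₁ ∈ s, t₁ < t₀ := by
        by_contra h
        push Not at h
        exact hγp.2 (γ t₀) (hasPastEndpoint_of_isLeast ⟨ht₀, h⟩)
      have hzy : (γ t₀ : 𝒱.carrier) ∈ g.chronologicalFuture τ {z} := by
        haveI : Fact ((1 : ℕ∞ω) ≤ ((⊤ : ℕ∞) : ℕ∞ω)) := ⟨hn1⟩
        haveI : CovariantDerivative.ContMDiffCovariantDerivative g.leviCivita 1 :=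
          ⟨g.toPseudoRiemannianMetric.isLocallyContMDiff_leviCivita_holds 1
            (by rw [show ((1 : ℕ∞) : ℕ∞ω) + 1 = 2 by norm_num]; exact WithTop.coe_le_coe.2 le_top)
            univ isOpen_univ⟩
        exact LorentzianMetric.mem_chronologicalFuture_of_hasPastEndpoint τ le_rfl hs' hγM hz ht₁ ht₀
          ht₁₀
      -- (G1a): the entry point `z` lies on `S`
      have hzS : z ∈ S := mem_initialBoundary_of_entry 𝒱 M p B Φ hCX hzcl hzG (γ t₀).2 hzy
      -- `J⁻(z) ∩ closure G ⊆ S`: on the data hypersurface by acausality, off it by (H)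
      have hHz : g.causalPast τ {z} ∩ closure G ⊆ S := by
        by_cases hzR : z ∈ range 𝒱.embed
        · intro x hx
          have hx' : x ∈ ({z} : Set 𝒱.carrier) :=
            causalPast_inter_causalFuture_range_embed 𝒱.toCauchyDevelopment hzR ⟨hx.1, hclG hx.2⟩
          rw [mem_singleton_iff] at hx'
          rw [hx']
          exact hzS
        · exact hH X D 𝒱 M p B Φ (Subtype.val ∘ γ) s z hCX hs' ⟨t₀, ht₀⟩ hγM (fun t _ ↦ (γ t).2) hz
            hzG hzR
      have hempty : g.causalPast τ {z} ∩ F = ∅ :=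
        Set.eq_empty_of_subset_empty fun x hx ↦ hx.2.2 (hSV (hHz ⟨hx.1, hx.2.1⟩))
      obtain ⟨W, hW, hWP⟩ :=
        exists_nhds_causalPast_inter_eq_empty 𝒱.toCauchyDevelopment hFc hFS hempty
      obtain ⟨t, ht, htW⟩ := hz.exists_mem_of_mem_nhds ⟨t₀, ht₀⟩ hW
      exact ⟨t, ht, (γ t).2, hWP _ htW⟩
  have hpastG : ∀ (γ : ℝ → GO) (s : Set ℝ), s.OrdConnected →
      (𝒱.metric.restrict PseudoRiemannianMetric.contMDiff_restrict_holds GO).IsFutureTimelikeCurveOn (𝒱.timeOrientation.restrict PseudoRiemannianMetric.contMDiff_restrict_holds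
        𝒱.timeOrientation.contMDiff_restrict_holds GO) γ s →
      ∀ t ∈ s, (γ t : 𝒱.carrier) ∈ P → ∀ t' ∈ s, t' ≤ t → (γ t' : 𝒱.carrier) ∈ P := by
    intro γ s hs' hγ t ht hγt t' ht' htt'
    have hγM := (LorentzianMetric.isFutureTimelikeCurveOn_restrict_iff _ _ _ _ GO).1 hγ
    refine hPpast _ hγt _ (γ t').2 (LorentzianMetric.mem_causalPast_singleton_iff.2 ?_)
    rcases htt'.eq_or_lt with rfl | hlt
    · exact LorentzianMetric.subset_causalFuture g τ _ (mem_singleton _)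
    · exact Or.inr ⟨γ t', rfl, Subtype.val ∘ γ, t', t, hlt,
        (hγM.mono (hs'.out ht' ht)).isFutureCausalCurveOn, rfl, rfl⟩
  have hCauchyG : (𝒱.metric.restrict PseudoRiemannianMetric.contMDiff_restrict_holds GO).IsCauchyHypersurface (𝒱.timeOrientation.restrict PseudoRiemannianMetric.contMDiff_restrict_holds
        𝒱.timeOrientation.contMDiff_restrict_holds GO)
      (Subtype.val ⁻¹' Sc) :=
    isCauchyHypersurface_of_pastSet (G := GO) (P := PO) _ _ hPG hScP3 hpastG hentry hCauchyP
  -- Step 4: the Killing development (FMM)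
  have hScGV : Sc ⊆ G ∩ V := fun y hy ↦ ⟨hPG (hScP3 hy), hPV (hScP3 hy)⟩
  obtain ⟨ξ', hξ'K, U', hU'o, hScU', hU'GV, hξ'ξ⟩ := hFMM 𝒱.toSpacetime 𝒱.isRicciFlat GO (G ∩ V) Sc ξ
    hCauchyG hScGV (hGo.inter hV) inter_subset_left hξ
  refine ⟨ξ', hξ'K, ?_⟩
  -- Step 5: a point of the exact diamond image inside `P`
  obtain ⟨x₀, hx₀, y₀P⟩ : ∃ x₀ ∈ Δ, Ψ x₀ ∈ P := by
    obtain ⟨xc, hxc, hclus⟩ := exists_slab_point_clusters (Φ₀ := Φ 0) hM hB hΨΦ hc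
    have hcC : Φ 0 xc ∈ C := image_truncTimeSlab_subset_collarCore M p B Φ 0 (mem_image_of_mem _ hxc)
    have hcR : Φ 0 xc ∈ range 𝒱.embed := hCX hcC
    have hcV : Φ 0 xc ∈ V := hSV (Or.inl hcC)
    have hempty : g.causalPast τ {Φ 0 xc} ∩ F = ∅ := by
      refine Set.eq_empty_of_subset_empty fun x hx ↦ ?_
      have hx' : x ∈ ({Φ 0 xc} : Set 𝒱.carrier) :=
        causalPast_inter_causalFuture_range_embed 𝒱.toCauchyDevelopment hcR ⟨hx.1, hclG hx.2.1⟩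
      rw [mem_singleton_iff] at hx'
      exact hx.2.2 (hx' ▸ hcV)
    obtain ⟨W, hW, hWP⟩ := exists_nhds_causalPast_inter_eq_empty 𝒱.toCauchyDevelopment hFc hFS hempty
    obtain ⟨x₀, hx₀, hx₀W⟩ := hclus W hW
    exact ⟨x₀, hx₀, hJ (mem_image_of_mem Ψ hx₀), hWP _ hx₀W⟩
  set y₀ := Ψ x₀ with hy₀
  -- Step 6: `ξ' = ξ` on the component `O` of `G ∩ V` through `y₀`
  haveI : LocallyConnectedSpace 𝒱.carrier := ChartedSpace.locallyConnectedSpace E4 𝒱.carrier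
  set O : Set 𝒱.carrier := connectedComponentIn (G ∩ V) y₀ with hO_def
  have hOo : IsOpen O := (hGo.inter hV).connectedComponentIn
  have hOGV : O ⊆ G ∩ V := connectedComponentIn_subset _ _
  have hy₀O : y₀ ∈ O := mem_connectedComponentIn ⟨hPG y₀P, hPV y₀P⟩
  have hOSc : (O ∩ U').Nonempty := by
    obtain ⟨K, hKc, hKP, hy₀K, z, hzK, hzSc⟩ :=
      exists_isPreconnected_meets (U := PO) _ _ hn2 hSc' y₀ y₀P
    have hKO : K ⊆ O := hKc.subset_connectedComponentIn hy₀K (hKP.trans fun y hy ↦ ⟨hPG hy, hPV hy⟩)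
    exact ⟨z, hKO hzK, hScU' hzSc⟩
  have hξO : ∀ y ∈ O, ξ' y = ξ y :=
    hG4 𝒱.toSpacetime O (O ∩ U') ξ' ξ hOo isPreconnected_connectedComponentIn (hOo.inter hU'o)
      inter_subset_left hOSc (hξ'K.mono fun y hy ↦ (hOGV hy).1) (hξ.mono hOGV)
      fun y hy ↦ hξ'ξ y hy.2
  -- Step 7: the anchor on the exact diamond (G3) and rigidity there (G4)
  have hΔo : IsOpen Δ := isOpen_slabDiamond' hB
  obtain ⟨ζ, hζK, hζΨ⟩ := hG3 𝒱.toSpacetime (M 0) (a 0) hM ha (mo 0) (B 0) hB Δ Ψ hΔo hs he hd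
  have hΨΔo : IsOpen (Ψ '' Δ) := by
    rw [← range_restrict]; exact he.isOpen_range
  have hΨΔc : IsPreconnected (Ψ '' Δ) :=
    (isPreconnected_slabDiamond' hM hB).image Ψ hs.continuousOn
  have hWne : (Ψ '' Δ ∩ O).Nonempty := ⟨y₀, mem_image_of_mem Ψ hx₀, hy₀O⟩
  have hξζ : ∀ y ∈ Ψ '' Δ, ξ' y = ζ y :=
    hG4 𝒱.toSpacetime (Ψ '' Δ) (Ψ '' Δ ∩ O) ξ' ζ hΨΔo hΨΔc (hΨΔo.inter hOo) inter_subset_left hWne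
      (hξ'K.mono hJ) hζK fun y hy ↦ by
        obtain ⟨⟨x, hx, rfl⟩, hyO⟩ := hy
        rw [hξO _ hyO, hξΨ x hx (hOGV hyO).2, hζΨ x hx]
  intro x hx
  rw [hξζ _ (mem_image_of_mem Ψ hx), hζΨ x hx]

end Summit.FinalStateConjecture.FinalStateConjecture.Theorems.BondiBartnikRigidity.DirectMethod

end
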